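import Literature.IUT.LogVolume.UnitLogCount
import Literature.IUT.LogVolume.RamificationInvariants
import HarnessLib

/-!
# When is `𝒪_K` a `p`-power multiple of `log_p(𝒪_K^×)`?  The VOLUME test ([IUTchIV] Prop. 1.4 (ii) count)

Proof-only companion (theorems, no definitions) of `UnitLogCount.lean` (campaign S: the Haar count
`μ_K(log_p(𝒪_K^×)) · #R^μ = μ_K(𝒪_K^×) = 1 − q⁻¹`, [IUTchIV] Prop. 1.4 (ii)) for the abc-iut cell's TEAM R
«ismDH mover» record (abc-iut-w5-d044, gen 5). Setting: `K` a finite extension of `ℚ_p` in the cell's norm-side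
form (`[NormedAlgebra ℚ_[p] K] [IsUltrametricDist K] [ProperSpace K]`), `q = residueCard K`, `e = absRamificationIdx p K`,
`#R^μ = {ζ | IsTorsionUnit K ζ}.ncard` (the roots of unity of `K`).

WHY. The BALL-MOVER CRITERION of the Dupuy–Hilado (Ind2) group (abc-iut-w5-d180, p432150
`forall_ismDH_image_closedBall_eq_iff`: the unit ball `𝒪_v` is fixed by EVERY lattice automorphism of the log-shell iff
`𝒪_v = p^k·log_p(𝒪_v^×)` for some `k ∈ ℤ`) reduces the (Ind2)-side negatives of the record (identified-copies reading,
w5-d216/w5-d180; PR-1's Θ-pin, w4-d087/w5-d044 `…_of_forall_ne`) to the question in the title. This file gives the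
test that needs NO computation of `log_p(𝒪_K^×)` and is uniform in `p`, `e`, `f`, tame or wild, `p = 2` included:

* `ncard_torsion_mul_residueCard_eq_of_closedBall_eq_zpow_smul_logUnits` — **if `𝒪_K = p^k·log_p(𝒪_K^×)` then
  `#R^μ · q = q^{−e·k} · (q − 1)`** (compare Haar volumes: `μ(𝒪) = 1`, `μ(p^k·Λ) = |p|_K^k·μ(Λ) = q^{−ek}·μ(Λ)`, and
  `μ(Λ) = (1 − q⁻¹)/#R^μ` by the Prop. 1.4 (ii) count);
* `closedBall_one_ne_zpow_smul_logUnits_of_forall_ne` — contrapositive, usable form: **if `(q − 1)·q^{e·j} ≠ #R^μ·q`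
  for every `j : ℕ`, then `𝒪_K ≠ p^k·log_p(𝒪_K^×)` for every `k ∈ ℤ`** (necessarily `k ≤ 0`).
  With `#R^μ = p^m·(q − 1)` this reads `e·f ∤ f + m`; e.g. `ℚ₂(√−1)` (`e = 2, f = 1, #R^μ = 4`): `4^j ≠ 8` — moved;
  `ℚ_5(ζ_5)` (`e = 4, f = 1, #R^μ = 20`): `4·5^{4j} ≠ 100` — moved; `ℚ_3(ζ_3)` (`2·3^{2j} = 18` at `j = 1`): test silent
  (and indeed `log_3(𝒪^×) = 3𝒪` there, G-c312-14-1); unramified odd `p` (`(q−1)q^j = (q−1)q` at `j = 1`): silent, as it must be.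

Classical `p`-adic measure theory (Weil, *Basic Number Theory*, Ch. I §4; [IUTchIV] Prop. 1.4 (ii) for the count). Nothing here
bears on the disputed [IUTchIII] Cor. 3.12; which reading of (Ind2) is print's is for the referee lanes.
[cite: WeilBNT1967, Ch. I §4, Th. 6] [cite: Mochizuki2012, IUTchIV Prop. 1.4 (ii) p. 13]
-/

noncomputable section

open MeasureTheory Set Metric
open scoped ENNReal NNReal Pointwise NormedField

namespace Literature.IUT.LogVolume

open Literature.NumberTheory.GaloisRepresentations.Ultrametric

variable (p : ℕ) [Fact p.Prime]
variable (K : Type*) [NontriviallyNormedField K] [instK : NormedAlgebra ℚ_[p] K] [IsUltrametricDist K] [ProperSpace K]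

omit [IsUltrametricDist K] [ProperSpace K] in
/-- `p ∈ K^×` as a unit. [folklore] -/
private theorem prime_isUnit : IsUnit ((p : ℕ) : K) := (prime_ne_zero p K).isUnit

/-- **Modulus of `p`**: `mod_K(p) = q^{−e}` — `p = ϖ^e·u` with `‖u‖ = 1`, `mod_K(ϖ) = q⁻¹`, `mod_K(u) = 1`.
[cite: WeilBNT1967, Ch. I §4, Th. 6] -/
theorem distribHaarChar_prime :
    distribHaarChar K (prime_isUnit p K).unit = ((residueCard K : ℝ≥0))⁻¹ ^ absRamificationIdx p K := by
  obtain ⟨ϖ, hϖ⟩ := exists_isUniformizer (F := K)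
  set P : Kˣ := (prime_isUnit p K).unit with hP
  have hPval : (P : K) = (p : K) := (prime_isUnit p K).unit_spec
  -- `u := P · ϖ^{-e}` has norm one
  set u : Kˣ := P * (ϖ ^ absRamificationIdx p K)⁻¹ with hu
  have hnu : ‖(u : K)‖ = 1 := by
    rw [hu, Units.val_mul, Units.val_inv_eq_inv_val, Units.val_pow_eq_pow_val, norm_mul, norm_inv, norm_pow,
      norm_pow_absRamificationIdx p K hϖ, hPval, norm_prime p K, mul_inv_cancel₀]
    exact inv_ne_zero (Nat.cast_ne_zero.mpr (Fact.out : p.Prime).ne_zero)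
  have hPeq : P = ϖ ^ absRamificationIdx p K * u := by rw [hu, mul_comm, inv_mul_cancel_right]
  rw [hPeq, map_mul, map_pow, distribHaarChar_uniformizer_eq K hϖ, distribHaarChar_eq_one_of_norm_eq_one u hnu, mul_one]

omit [IsUltrametricDist K] [ProperSpace K] in
/-- The `ℚ_p`-scalar multiple `p^k • A` of a set is the unit multiple `(p : K^×)^k • A`. [folklore] -/
private theorem zpow_prime_smul_set_eq_units_smul (k : ℤ) (A : Set K) :
    ((p : ℚ_[p]) ^ k) • A = ((prime_isUnit p K).unit ^ k) • A := by
  have hval : (((prime_isUnit p K).unit ^ k : Kˣ) : K) = algebraMap ℚ_[p] K ((p : ℚ_[p]) ^ k) := by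
    rw [Units.val_zpow_eq_zpow_val, (prime_isUnit p K).unit_spec, map_zpow₀, map_natCast]
  ext x
  simp only [Set.mem_smul_set, Units.smul_def, smul_eq_mul, Algebra.smul_def, hval]

variable [MeasurableSpace K] [BorelSpace K]

/-- **`μ_K(p^k·A) = q^{−e·k}·μ_K(A)`** for every set `A` and `k ∈ ℤ`. [cite: WeilBNT1967, Ch. I §4, Th. 6] -/
theorem localVolume_zpow_prime_smul (k : ℤ) (A : Set K) :
    localVolume K (((p : ℚ_[p]) ^ k) • A) =
      ((((residueCard K : ℝ≥0))⁻¹ ^ absRamificationIdx p K) ^ k : ℝ≥0) * localVolume K A := by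
  rw [zpow_prime_smul_set_eq_units_smul p K k A, localVolume_units_smul, map_zpow, distribHaarChar_prime p K]

/-- **THE VOLUME IDENTITY**: if `𝒪_K = p^k·log_p(𝒪_K^×)` for some `k ∈ ℤ`, then `#R^μ · q = q^{−e·k}·(q − 1)` in `ℝ`
(`μ(𝒪) = 1`, `μ(p^k·Λ) = q^{−ek}·μ(Λ)`, `μ(Λ)·#R^μ = 1 − q⁻¹`). [cite: Mochizuki2012, IUTchIV Prop. 1.4 (ii) p. 13] -/
theorem ncard_torsion_mul_residueCard_eq_of_closedBall_eq_zpow_smul_logUnits {k : ℤ}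
    (h : closedBall (0 : K) 1 = ((p : ℚ_[p]) ^ k) • (logUnits K : Set K)) :
    ({ζ : K | IsTorsionUnit K ζ}.ncard : ℝ) * residueCard K =
      (residueCard K : ℝ) ^ (-((absRamificationIdx p K : ℤ) * k)) * ((residueCard K : ℝ) - 1) := by
  have hq : (1 : ℝ) < residueCard K := one_lt_residueCard_real K
  have hq0 : (residueCard K : ℝ) ≠ 0 := by positivity
  have hN : (0 : ℝ) < {ζ : K | IsTorsionUnit K ζ}.ncard := by exact_mod_cast ncard_isTorsionUnit_pos p K
  -- volumes of both sides of `h`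
  have hvol := congrArg (fun S : Set K => (localVolume K S).toReal) h
  simp only [localVolume_closedBall_one, ENNReal.toReal_one] at hvol
  rw [localVolume_zpow_prime_smul p K, ENNReal.toReal_mul, ENNReal.coe_toReal, localVolume_real_logUnits p K] at hvol
  -- `hvol : 1 = (q⁻¹^e)^k * ((1 - q⁻¹) / N)`; clear denominators
  push_cast at hvol
  rw [eq_comm, mul_div_assoc', div_eq_one_iff_eq hN.ne'] at hvol
  -- `hvol : (q⁻¹ ^ e) ^ k * (1 - q⁻¹) = N`
  have hpow : (((residueCard K : ℝ))⁻¹ ^ absRamificationIdx p K) ^ k =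
      (residueCard K : ℝ) ^ (-((absRamificationIdx p K : ℤ) * k)) := by
    rw [inv_pow, ← zpow_natCast, inv_zpow', ← zpow_mul, mul_neg]
  calc ({ζ : K | IsTorsionUnit K ζ}.ncard : ℝ) * residueCard K
      = (((residueCard K : ℝ))⁻¹ ^ absRamificationIdx p K) ^ k * (1 - ((residueCard K : ℝ))⁻¹) * residueCard K := by
        rw [hvol]
    _ = (residueCard K : ℝ) ^ (-((absRamificationIdx p K : ℤ) * k)) * ((residueCard K : ℝ) - 1) := by
        rw [hpow, mul_assoc, sub_mul, one_mul, inv_mul_cancel₀ hq0]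

/-- Consequence of the count: such a `k` is `≤ 0` (`#R^μ·q ≥ q > q − 1 ≥ q^{−ek}(q−1)` if `k ≥ 1`).
[cite: Mochizuki2012, IUTchIV Prop. 1.4 (ii) p. 13] [cite: WeilBNT1967, Ch. I §4, Th. 6] -/
theorem nonpos_of_closedBall_eq_zpow_smul_logUnits {k : ℤ}
    (h : closedBall (0 : K) 1 = ((p : ℚ_[p]) ^ k) • (logUnits K : Set K)) : k ≤ 0 := by
  by_contra hk
  push Not at hk
  have hq : (1 : ℝ) < residueCard K := one_lt_residueCard_real K
  have hN1 : (1 : ℝ) ≤ {ζ : K | IsTorsionUnit K ζ}.ncard := by exact_mod_cast ncard_isTorsionUnit_pos p K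
  have he : 1 ≤ absRamificationIdx p K := absRamificationIdx_pos p K
  have hid := ncard_torsion_mul_residueCard_eq_of_closedBall_eq_zpow_smul_logUnits p K h
  -- LHS ≥ q, RHS < q
  have hexp : -((absRamificationIdx p K : ℤ) * k) ≤ -1 := by
    have : (1 : ℤ) ≤ (absRamificationIdx p K : ℤ) * k := by nlinarith
    omega
  have hR : (residueCard K : ℝ) ^ (-((absRamificationIdx p K : ℤ) * k)) * ((residueCard K : ℝ) - 1) <
      residueCard K := by
    have h1 : (residueCard K : ℝ) ^ (-((absRamificationIdx p K : ℤ) * k)) ≤ (residueCard K : ℝ) ^ (-1 : ℤ) :=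
      zpow_le_zpow_right₀ hq.le hexp
    have h2 : (residueCard K : ℝ) ^ (-1 : ℤ) * ((residueCard K : ℝ) - 1) < residueCard K := by
      rw [zpow_neg_one, inv_mul_eq_div, div_lt_iff₀ (by linarith)]
      nlinarith
    have h3 : (0 : ℝ) ≤ (residueCard K : ℝ) - 1 := by linarith
    exact (mul_le_mul_of_nonneg_right h1 h3).trans_lt h2
  have hL : (residueCard K : ℝ) ≤ ({ζ : K | IsTorsionUnit K ζ}.ncard : ℝ) * residueCard K :=
    le_mul_of_one_le_left (by linarith) hN1
  linarith

/-- **THE VOLUME TEST (usable form).** If `(q − 1)·q^{e·j} ≠ #R^μ·q` for every `j : ℕ`, then the unit ball `𝒪_K` is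
NOT of the form `p^k·log_p(𝒪_K^×)`, `k ∈ ℤ` — hence (abc-iut-w5-d180's `forall_ismDH_image_closedBall_eq_iff`, p432150) it is
MOVED by some Dupuy–Hilado (Ind2) lattice automorphism of the log-shell. With `#R^μ = p^m(q−1)`: the test is `e·f ∤ f + m`.
[cite: Mochizuki2012, IUTchIV Prop. 1.4 (ii) p. 13] [cite: WeilBNT1967, Ch. I §4, Th. 6] -/
theorem closedBall_one_ne_zpow_smul_logUnits_of_forall_ne
    (hne : ∀ j : ℕ, ((residueCard K : ℝ) - 1) * (residueCard K : ℝ) ^ (absRamificationIdx p K * j) ≠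
      ({ζ : K | IsTorsionUnit K ζ}.ncard : ℝ) * residueCard K) :
    ∀ k : ℤ, closedBall (0 : K) 1 ≠ ((p : ℚ_[p]) ^ k) • (logUnits K : Set K) := by
  intro k h
  have hk := nonpos_of_closedBall_eq_zpow_smul_logUnits p K h
  have hid := ncard_torsion_mul_residueCard_eq_of_closedBall_eq_zpow_smul_logUnits p K h
  obtain ⟨j, hj⟩ : ∃ j : ℕ, (j : ℤ) = -k := ⟨(-k).toNat, Int.toNat_of_nonneg (by omega)⟩
  refine hne j ?_
  rw [hid, mul_comm ((residueCard K : ℝ) - 1), ← zpow_natCast]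
  congr 2
  push_cast
  rw [hj]; ring

end Literature.IUT.LogVolume

end
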